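import Summits.AtomisticToContinuum.BoseEinsteinCondensation.Theorems.BlockLatticeFSumBlockCondensationCarving
import Summits.AtomisticToContinuum.BoseEinsteinCondensation.Theorems.BlockLatticeFSumBlockCondensationCellNEngine
import Summits.AtomisticToContinuum.BoseEinsteinCondensation.Theorems.BlockLatticeFSumBlockCondensationFloorPos
import Summits.AtomisticToContinuum.BoseEinsteinCondensation.Theorems.BlockLatticeFSumBlockCondensationCellNTransport
import HarnessLib

/-!
# `BlockCondensation` (stmt-AtomisticToContinuum-13595) PROVED — routes `BlockLatticeFSum` (rank 3)
# and `BECIntegerBlockRotor` (rank 5)  (decomp-a2c · hand-1 g9 close; lens-6 g27/g28 carving,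
# hand-2 g8 P1/P4, hand-1 g9 P3)

Assembly of the carving of the crux `BlockCondensation` (GP-scale block floor of periodic
near-minimisers of the Bose gas): every piece is a tree theorem, so the crux follows BY NAME for
both route files (one decl body).

* U = `LSSY2005_upperBound_periodic_holds` (tree) and the block-mode identity give
  `BlockCondensation ⟸ F ⟸ F♭` (`BlockCondensationCarving`, lens-6 g27).
* F♭ = `CellNBudgetBlockFloor` splits as F♭₊ (positive scattering length) ∧ F♭₀ (zero scattering
  length) — `cellNBudgetBlockFloor_of_pos_zero` below.
* F♭₀ = `cellNBudgetBlockFloorZero_holds` (spec `BlockCondensationCellNEngine`, engine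
  `cellN_key_inequality`, hand-2 g8).
* F♭₊ ⟸ `CellNEngine` = `cellNBudgetBlockFloorPos_of_engine` (P3, hand-1 g9), and
  `CellNEngine` = `cellN_engine` (P1, hand-2 g8: `natCast_le_sum_occupation_add_budget` transported
  to the cellN carrier) — `cellNEngine_holds` below.

Main theorems: `blockCondensation_proof : Theses.BlockLatticeFSum.BlockCondensation` and
`rotor_blockCondensation_proof : Theses.BECIntegerBlockRotor.BlockCondensation`.
[cite: LSSY2005, Thm. 5.1 (5.15)–(5.17), Lemma 5.2, Lemma 4.1, Thm. 2.2 (2.14), Thm. 2.4 (2.35)].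
No definitions, no `sorry`.
-/

noncomputable section

namespace Summit.AtomisticToContinuum.BoseEinsteinCondensation.Theorems.BlockCondensation

open Literature.MathematicalPhysics.QuantumManyBody.BoseGas
open BlockCondensationCarving (CellNBudgetBlockFloor PeriodicBudgetBlockFloor)
open BlockCondensationCellNEngine (CellNEngine CellNBudgetBlockFloorPos CellNBudgetBlockFloorZero
  cellNBudgetBlockFloorZero_holds)

/-- **P1 discharged**: the cellN-carrier engine `CellNEngine` IS the tree theorem `cellN_engine`
(`BlockLatticeFSumBlockCondensationCellNTransport`, hand-2 g8), binder for binder.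
[cite: LSSY2005, Lemma 5.2 (5.7)–(5.14), (5.15)–(5.17)] -/
theorem cellNEngine_holds : CellNEngine :=
  BlockLatticeFSumBlockCondensationCellNTransport.cellN_engine

/-- **F♭₊ holds**: the positive-scattering-length half of the boundary-condition-free block floor
(P3 applied to P1). [cite: LSSY2005, Thm. 5.1 (5.15)–(5.17)] -/
theorem cellNBudgetBlockFloorPos_holds : CellNBudgetBlockFloorPos :=
  BlockCondensationFloorPos.cellNBudgetBlockFloorPos_of_engine cellNEngine_holds

/-- **F♭ ⟸ F♭₊ ∧ F♭₀** (case split on the scattering length). [folklore] -/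
theorem cellNBudgetBlockFloor_of_pos_zero (hpos : CellNBudgetBlockFloorPos)
    (hzero : CellNBudgetBlockFloorZero) : CellNBudgetBlockFloor := by
  intro v hv A hA η hη
  rcases eq_or_ne (scatteringLength v) 0 with h0 | h0
  · exact hzero v hv h0 A hA η hη
  · exact hpos v hv (pos_iff_ne_zero.2 h0) A hA η hη

/-- **F♭ holds**: the block floor for every Bose-symmetric `C¹` function normalised on `[0,L)^{3N}`
under the plain cell-energy budget `(4πa + τ)(N/L³)N`, box-uniformly, at every even block number in
the GP window. [cite: LSSY2005, Thm. 5.1 (5.15)–(5.17), Lemma 5.2] -/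
theorem cellNBudgetBlockFloor_holds : CellNBudgetBlockFloor :=
  cellNBudgetBlockFloor_of_pos_zero cellNBudgetBlockFloorPos_holds cellNBudgetBlockFloorZero_holds

/-- **F holds**: the budget-form block floor for periodic trial states.
[cite: LSSY2005, Thm. 5.1 (5.15)–(5.17)] -/
theorem periodicBudgetBlockFloor_holds : PeriodicBudgetBlockFloor :=
  BlockCondensationCarving.periodicBudgetBlockFloor_of_cellN cellNBudgetBlockFloor_holds

/-- **`BlockCondensation` (route `BlockLatticeFSum`, rank 3; item stmt-AtomisticToContinuum-13595)
PROVED**: near-minimisers of the periodic Bose gas at density `ρ ≤ ρ₀` condense, up to a fraction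
`η`, into the block constant modes of every even block lattice in the Gross–Pitaevskii window
`A/√ρ ≤ L/K ≤ 2A/√ρ`. [cite: LSSY2005, Thm. 5.1, Lemma 5.2, Thm. 2.2 (2.14)] -/
theorem blockCondensation_proof : Theses.BlockLatticeFSum.BlockCondensation :=
  BlockCondensationCarving.blockCondensation_of_cellNFloor cellNBudgetBlockFloor_holds

/-- **`BlockCondensation` (route `BECIntegerBlockRotor`, rank 5; same decl body) PROVED.**
[cite: LSSY2005, Thm. 5.1, Lemma 5.2, Thm. 2.2 (2.14)] -/
theorem rotor_blockCondensation_proof : Theses.BECIntegerBlockRotor.BlockCondensation :=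
  BlockCondensationCarving.rotor_blockCondensation_of_cellNFloor cellNBudgetBlockFloor_holds

end Summit.AtomisticToContinuum.BoseEinsteinCondensation.Theorems.BlockCondensation

end
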